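import Summits.BirchSwinnertonDyer.BirchSwinnertonDyer.Theses.PrintX9
import Summits.BirchSwinnertonDyer.BirchSwinnertonDyer.Theorems.PrintX9HowardContainmentLightFrameOfPrintDepthPosLocalized
import Literature.NumberTheory.EllipticCurves.HeegnerEnvelopeCoherentPairProofs
import Literature.NumberTheory.EllipticCurves.HeegnerGeomCoherentDataOfFrameProofs
import HarnessLib

/-!
# Stub `stub_envelopeModulesSharp` of line `torsion-depth-pinned` on crux
# `PrintX9.HowardContainmentLightFramePinnedOfPrintSharp` (stmt-BirchSwinnertonDyer-27077), BY SIGNATURE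

Cell `pub/bsd-print-x9`, LEAD `bsd-line-x9-p1` (g0'), registrar of the skeleton v5 on 27077 (evidence #2, sha16
41780ebaa49d9ea2; `ledger skeleton check` OK). The registered stub `stub_envelopeModulesSharp : Stmt.envelopeModulesSharp`
is the MODULE-LEVEL Heegner envelope (x9-p1-w2's junk-split letter with the Tower♯ binder): from `K_k ⊆ K[p^{k+1}]`
(route item `AnticyclotomicTowerSharp`), on every rank-one light X9 Heegner frame, for the given `jbar` and every
`Λ`-adic Selmer datum `D`, a CGLS `d(k)`-shifted stabilised datum `C` and a Howard family `F`, BOTH on the frame's own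
parametrisation `Dt`, an exponent `e` and `g ≠ 0` in `Λ` with the forward inclusion `(p^e) • ℋ_∞(F) ≤ Λκ_∞(C)` and the
reverse inclusion `g • Λκ_∞(C) ≤ ℋ_∞(F)`.

PROOF = the cell's envelope engine, BY NAME, with `e = 0` and `g = ω_δ`:
`Literature.NumberTheory.EllipticCurves.exists_coherent_pair_envelope` (x9-p2, `HeegnerEnvelopeCoherentPairProofs`:
the coherent pair `(C₀, F₀)` on ONE principal system — constructors of x9-p1 g1 `HeegnerGeomCoherentDataProofs`;
point identities (P1′)(P1″)(P2′) of x9-p1-w2 `HeegnerGeomStabilizedPointIdentitiesProofs` with a Lucas pair at the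
actual shift jumps and (P3) of x9-p1 g0' `HeegnerGeomCoherentFamilyIdentityProofs`; Kummer descent / universal norms /
Krull `heegnerModule_le_stabilizedHeegnerModule_of_coherent` and the triangular reverse
`exists_ne_zero_smul_stabilizedHeegnerModule_le_heegnerModule_of_coherent` of x9-p2) fed with the FRAME data:
`p` odd and good ordinary and `E(K)[p] = 0` from the X9 census / `X9.thm413Hypotheses_of_lightFrame`, `[K[p] : K[1]] =
p − 1` from `p` split and `d_K` odd `≠ −3` (`card_ringClassGalOver_prime_one_of_frame`, x9-p1 g0'
`HeegnerGeomCoherentDataOfFrameProofs`), the orientation `H.β` of the frame's Heegner datum, and the tower binder.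
PRINT-content (Howard 2004 §3.3 / Thm. 3.3.7 "generate"; Perrin-Riou 1987 §3.4 Prop. 10; CGLS 2022 Rem. 4.1.4 "`κ_∞` and
`κ₁^{Hg}` generate the same `Λ`-submodule") proved in the tree at EVERY class number; no named fact is used.
«beyond-print theorem»: no. BSD is NOT proved by this file; no summit statement is proved by it.
-/

set_option linter.dupNamespace false
set_option autoImplicit false

noncomputable section

open scoped Classical Pointwise
open Literature Literature.NumberTheory.EllipticCurves WeierstrassCurve
  Literature.NumberTheory.EllipticCurves.ModularForms
open Summit.BirchSwinnertonDyer.BirchSwinnertonDyer.Theses.PrintX9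

namespace Summit.BirchSwinnertonDyer.BirchSwinnertonDyer.Theorems.PrintX9SharpEnvelope

/-- **REGISTERED STUB STATEMENT `Stmt.envelopeModulesSharp`** of the skeleton v5 on stmt-BirchSwinnertonDyer-27077
(namespace `…Cruxes.HowardContainmentLightFramePinnedOfPrintSharp.TorsionDepthPinned`, evidence #2), VERBATIM, re-homed
under this Theorems-side namespace (the skeleton is not importable; the two texts are syntactically identical under the
same `open`s). A statement abbreviation WITH a kernel-closed witness in this module (`stub_envelopeModulesSharp`),
not a named fact. -/
abbrev Stmt.envelopeModulesSharp : Prop :=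
  AnticyclotomicTowerSharp →
    ∀ (W : WeierstrassCurve ℚ) [W.IsElliptic] [W.IsGloballyMinimal] (p : ℕ) [Fact p.Prime]
      [NeZero (W.conductorNorm ℤ)] (K : Type) [Field K] [NumberField K],
      Summit.BirchSwinnertonDyer.BirchSwinnertonDyer.Rank1Residual.ClassX9 W p →
      IsImaginaryQuadratic K → Odd (NumberField.discr K) → NumberField.discr K ≠ -3 →
      SatisfiesHeegnerHypothesis (W.conductorNorm ℤ) K → SatisfiesHeegnerHypothesis p K →
      (W.baseChange K).HasIrreducibleModPGaloisRep p →
      ∀ (κ : ZpExtension K p), κ.IsAnticyclotomic → ∀ (γ : Field.absoluteGaloisGroup K),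
      κ.IsTopGenerator γ →
      ∀ (Dt : ModularForms.ModularParametrizationData W (W.conductorNorm ℤ))
        (H : HeegnerDatum (W.conductorNorm ℤ) (NumberField.discr K))
        (jbar : AlgebraicClosure K →+* ℂ) (D : (W.baseChange K).LambdaAdicSelmerData κ γ),
      ¬ (p : ℤ) ∣ Dt.c →
      ∃ (C : CastellaGrossiLeeSkinner2022.StabilizedHeegnerData (W.conductorNorm ℤ) W K κ jbar)
        (F : HeegnerFamily (W.conductorNorm ℤ) W K κ jbar) (e : ℕ) (g : IwasawaAlgebra p),
        C.Dt = Dt ∧ F.Dt = Dt ∧ g ≠ 0 ∧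
        ((p : IwasawaAlgebra p) ^ e) • heegnerModule D F ≤
          CastellaGrossiLeeSkinner2022.stabilizedHeegnerModule D C ∧
        g • CastellaGrossiLeeSkinner2022.stabilizedHeegnerModule D C ≤ heegnerModule D F

/-- **Stub `stub_envelopeModulesSharp` (line `torsion-depth-pinned`, crux stmt-BirchSwinnertonDyer-27077), BY
SIGNATURE — the module-level Heegner envelope at EVERY class number with `e = 0`, `g = ω_δ = (1+T)^{p^δ} − 1`**:
`exists_coherent_pair_envelope` at the frame (ordinary and `E(K)[p] = 0` from the X9 census via
`X9.thm413Hypotheses_of_lightFrame`; `[K[p] : K[1]] = p − 1` from `card_ringClassGalOver_prime_one_of_frame`; the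
orientation of `H`; the tower binder at the odd prime `p`). [cite: CastellaGrossiLeeSkinner2022, Rem. 4.1.4 (κ_∞ and κ₁^{Hg} generate the same Λ-submodule)]
[cite: Howard2004HeegnerKolyvagin, §3.3 and Thm. 3.3.7] [cite: PerrinRiou1987BSMF, §3.4 Prop. 10] -/
theorem stub_envelopeModulesSharp : Stmt.envelopeModulesSharp := by
  intro hTw W _ _ p _ _ K _ _ hX9 hK hodd h3 hHN hHp _ κ hκ γ hγ Dt H jbar D _
  have hp : p.Prime := Fact.out
  have hX9' := Summit.BirchSwinnertonDyer.BirchSwinnertonDyer.Rank1Residual.classX9_census_of_classX9 W p hX9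
  have hp_odd : Odd p := hp.odd_of_ne_two hX9'.ne_two
  have hyp := Summit.BirchSwinnertonDyer.Rank1Residual.X9.thm413Hypotheses_of_lightFrame hX9' hK hodd h3 hHN hHp
    hκ hγ
  obtain ⟨C, F, hCDt, hFDt, -, -, hfwd, g, hg, hrev⟩ :=
    exists_coherent_pair_envelope (W := W) hK hHN Dt H.dvd_sq_sub jbar hyp.ordinary hX9'.not_dvd_conductorNorm κ
      hγ (fun k ↦ hTw K p hp_odd hK κ hκ jbar k)
      (card_ringClassGalOver_prime_one_of_frame hK hodd h3 hp hHp jbar) hyp.noPTorsion D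
  refine ⟨C, F, 0, g, hCDt, hFDt, hg, ?_, hrev⟩
  rw [pow_zero, one_smul]
  exact hfwd

end Summit.BirchSwinnertonDyer.BirchSwinnertonDyer.Theorems.PrintX9SharpEnvelope

end
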